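import Summits.QuantumFields.YangMills.Theorems.SoloBlindClusteringAntipodal
import Summits.QuantumFields.YangMills.Theorems.SoloBlindOddTorusCorrelator
import HarnessLib

/-!
# The IR-0 skeleton on the statement's tori: a local ratio bound forbids a uniform rate
# (solo-QuantumFields-blind, rung D9)

`Summit.QuantumFields.YangMills.Theorems.SoloBlindNoUniformRate` (read-only conjunct `YangMills`).
The necessary infrared fact IR-0 ("the correlation length in lattice units diverges as
`β → ∞`") was proved at paper level by this unit from LOCAL GAUSSIANITY (the short-distance
connected correlators of a time-zero spatial observable approach fixed Gaussian ratios, uniformly in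
the volume) plus the polynomial decay of the lattice free-field ratios.  This file kernel-checks
the COMBINATORIAL half of that argument on the statement's own odd tori, with the analytic input
typed as a hypothesis:

* `latticeConnectedCorr_self_le_interpolate` — for a time-zero spatial species `A`, `β ≥ 0`,
  `S ≥ 1`: if `c_{A,A}(0; S) > 0` and `c_{A,A}(S; S) ≤ C e^{-m₀ S}` with `C > 0`, then for every
  `n ≤ S`, `c_{A,A}(n; S) ≤ c_{A,A}(0; S) · (C / c_{A,A}(0; S))^{n/S} · e^{-m₀ n}` (two-endpoint
  geometric interpolation of a non-negative log-convex sequence, parts 2–4);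
* `not_clustersAtRate_of_ratio_lower_bound` — hence if, for all large `S`,
  `c_{A,A}(0; S) ≥ δ > 0` and `c_{A,A}(n; S) ≥ ρ₀ · c_{A,A}(0; S)` with `ρ₀ > e^{-m₀ n}` (the typed
  local-Gaussianity input at ONE separation `n`), then the pair `(A, A)` does NOT cluster
  torus-uniformly at rate `m₀` at this `β` (`¬ ClustersAtRate r β A A m₀`);
* `correlationLengthDiverges_of_localRatios` — the IR-0 form: if such inputs hold eventually in
  `β` for every `m₀ > 0`, no rate survives at weak coupling.

No analysis is done here: the content of IR-0 is in the hypothesis; the file certifies that the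
reflection-positivity structure (log-convexity on the odd tori) turns a ONE-separation ratio bound
into the absence of a uniform exponential rate.  [this unit's; mechanism folklore]
-/

open MeasureTheory Filter Topology
open Literature.MathematicalPhysics.QuantumFieldTheory Literature.MathematicalPhysics.QuantumLattice

noncomputable section

namespace Summit.QuantumFields.YangMills.Theorems.SoloBlind

variable {G : Type} [Group G] [TopologicalSpace G] [IsTopologicalGroup G] [CompactSpace G]
  [MeasurableSpace G] [BorelSpace G]

/-- **Torus-uniform clustering of the pair `(A, B)` at bare coupling `β` AT RATE `m₀`** (lattice
units): `|c_{A,B}(n; S)| ≤ C e^{-m₀ n}` for all `n ≤ S` on every odd torus `2S+1 ≥ 2S₀+1`.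
`ClustersUniformlyAt r β A B` (rung D3) is `∃ m₀ > 0, ClustersAtRate r β A B m₀`. -/
def ClustersAtRate (r : LatticeRep G) (β : ℝ) (A B : YMSpecies G) (m₀ : ℝ) : Prop :=
  ∃ C : ℝ, ∃ S₀ : ℕ, ∀ S : ℕ, S₀ ≤ S → ∀ n : ℕ, n ≤ S →
    |latticeConnectedCorr r.ρ β (2 * S + 1) A.F B.F n| ≤ C * Real.exp (-(m₀ * n))

/-- `ClustersUniformlyAt` is clustering at some positive rate. -/
theorem clustersUniformlyAt_iff_exists_rate (r : LatticeRep G) (β : ℝ) (A B : YMSpecies G) :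
    ClustersUniformlyAt r β A B ↔ ∃ m₀ : ℝ, 0 < m₀ ∧ ClustersAtRate r β A B m₀ :=
  ⟨fun ⟨C, m, hm, S₀, h⟩ => ⟨m, hm, C, S₀, h⟩, fun ⟨m, hm, C, S₀, h⟩ => ⟨C, m, hm, S₀, h⟩⟩

/-- Clustering at rate `m₀` implies clustering at every smaller rate. -/
theorem ClustersAtRate.mono {r : LatticeRep G} {β : ℝ} {A B : YMSpecies G} {m₀ m₁ : ℝ}
    (h : ClustersAtRate r β A B m₀) (hm : m₁ ≤ m₀) : ClustersAtRate r β A B m₁ := by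
  obtain ⟨C, S₀, hC⟩ := h
  refine ⟨max C 0, S₀, fun S hS n hn => (hC S hS n hn).trans ?_⟩
  have hn0 : (0 : ℝ) ≤ n := Nat.cast_nonneg n
  calc C * Real.exp (-(m₀ * n)) ≤ max C 0 * Real.exp (-(m₀ * n)) :=
        mul_le_mul_of_nonneg_right (le_max_left _ _) (Real.exp_pos _).le
    _ ≤ max C 0 * Real.exp (-(m₁ * n)) :=
        mul_le_mul_of_nonneg_left (Real.exp_le_exp.mpr (by nlinarith)) (le_max_right _ _)

/-! ### Two-endpoint interpolation on the time-zero spatial diagonal -/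

/-- **Two-endpoint geometric interpolation** (time-zero spatial `A`, `β ≥ 0`, `S ≥ 1`, every
compact `G`): if `c(0; S) > 0` and `c(S; S) ≤ C e^{-m₀ S}` with `C > 0`, then
`c(n; S) ≤ c(0; S) · (C / c(0; S))^{n/S} · e^{-m₀ n}` for all `n ≤ S` — log-convexity and
non-negativity of `n ↦ c_{A,A}(n; S)` (parts 2–4) and `mulConvex_le_geometric`. [this unit's] -/
theorem latticeConnectedCorr_self_le_interpolate {N : ℕ} (ρ : G →* Matrix (Fin N) (Fin N) ℂ)
    (hρ : Continuous ρ) {β : ℝ} (hβ : 0 ≤ β) {S : ℕ} (hS : 1 ≤ S) (A : YMSpecies G)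
    (hA : IsTimeZeroSpatial A) (h0 : 0 < latticeConnectedCorr ρ β (2 * S + 1) A.F A.F 0)
    {C m₀ : ℝ} (hC : 0 < C)
    (hSC : latticeConnectedCorr ρ β (2 * S + 1) A.F A.F S ≤ C * Real.exp (-(m₀ * S)))
    {n : ℕ} (hn : n ≤ S) :
    latticeConnectedCorr ρ β (2 * S + 1) A.F A.F n ≤
      latticeConnectedCorr ρ β (2 * S + 1) A.F A.F 0 *
        (C / latticeConnectedCorr ρ β (2 * S + 1) A.F A.F 0) ^ ((n : ℝ) / S) *
          Real.exp (-(m₀ * n)) := by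
  set c0 := latticeConnectedCorr ρ β (2 * S + 1) A.F A.F 0 with hc0
  have hq : 0 < C / c0 := div_pos hC h0
  -- the ratio `θ = (C/c0)^{1/S} e^{-m₀}`
  set θ : ℝ := (C / c0) ^ ((1 : ℝ) / S) * Real.exp (-m₀) with hθ
  have hθpos : 0 < θ := mul_pos (Real.rpow_pos_of_pos hq _) (Real.exp_pos _)
  have hS0 : (0 : ℝ) < S := by exact_mod_cast hS
  have hθpow : ∀ j : ℕ, θ ^ j = (C / c0) ^ ((j : ℝ) / S) * Real.exp (-(m₀ * j)) := by
    intro j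
    rw [hθ, mul_pow, ← Real.rpow_natCast ((C / c0) ^ ((1 : ℝ) / S)) j, ← Real.rpow_mul hq.le,
      ← Real.exp_nat_mul]
    congr 1
    · congr 1; field_simp
    · ring_nf
  have hθS : θ ^ S = C / c0 * Real.exp (-(m₀ * S)) := by
    rw [hθpow S, div_self hS0.ne', Real.rpow_one]
  -- apply the endpoint lemma to `a k = c(k; S)` on `[0, S]` with constant `c0`
  have hgeo := mulConvex_le_geometric
    (a := fun k => latticeConnectedCorr ρ β (2 * S + 1) A.F A.F k) (K := S)
    (fun k _ => latticeConnectedCorr_self_nonneg ρ hρ hβ hS A hA k)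
    (fun k hk => latticeConnectedCorr_self_logConvex ρ hρ hβ hS A hA k (by omega)) hθpos
    (C := c0) le_rfl (by rw [hθS]; calc
      latticeConnectedCorr ρ β (2 * S + 1) A.F A.F S ≤ C * Real.exp (-(m₀ * S)) := hSC
      _ = c0 * (C / c0 * Real.exp (-(m₀ * S))) := by field_simp) hn
  simpa [hθpow n, mul_assoc] using hgeo

/-! ### No uniform rate from a one-separation ratio bound -/

/-- `(b)^{n/S} → 1` as `S → ∞` (`b > 0`, `n` fixed). [folklore] -/
private theorem tendsto_rpow_div_atTop_one {b : ℝ} (hb : 0 < b) (n : ℕ) :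
    Tendsto (fun S : ℕ => b ^ ((n : ℝ) / S)) atTop (𝓝 1) := by
  have h1 : Tendsto (fun S : ℕ => (n : ℝ) / S) atTop (𝓝 0) :=
    tendsto_const_div_atTop_nhds_zero_nat (n : ℝ)
  have h2 : ContinuousAt (fun x : ℝ => b ^ x) 0 := Real.continuousAt_const_rpow hb.ne'
  have h3 := h2.tendsto.comp h1
  rw [Real.rpow_zero] at h3
  exact h3

/-- **A one-separation ratio lower bound forbids torus-uniform clustering at rate `m₀`.**  Let
`A` be time-zero spatial and `β ≥ 0`.  If for all large `S` the on-site variance is bounded below,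
`c_{A,A}(0; S) ≥ δ > 0`, and at ONE separation `n` the ratio obeys
`c_{A,A}(n; S) ≥ ρ₀ · c_{A,A}(0; S)` with `ρ₀ > e^{-m₀ n}`, then `¬ ClustersAtRate r β A A m₀`.
(The hypothesis is the typed content of local Gaussianity at large `β`: the ratio tends to the
lattice free-field value `κ(n)/κ(0)`, which decays only polynomially in `n`.) [this unit's] -/
theorem not_clustersAtRate_of_ratio_lower_bound (r : LatticeRep G) {β : ℝ} (hβ : 0 ≤ β)
    (A : YMSpecies G) (hA : IsTimeZeroSpatial A) {m₀ ρ₀ δ : ℝ} {n : ℕ} (hδ : 0 < δ)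
    (hρ₀ : Real.exp (-(m₀ * n)) < ρ₀)
    (hLG : ∀ᶠ S : ℕ in atTop, δ ≤ latticeConnectedCorr r.ρ β (2 * S + 1) A.F A.F 0 ∧
      ρ₀ * latticeConnectedCorr r.ρ β (2 * S + 1) A.F A.F 0 ≤
        latticeConnectedCorr r.ρ β (2 * S + 1) A.F A.F n) :
    ¬ ClustersAtRate r β A A m₀ := by
  rintro ⟨C, S₀, hC⟩
  have hρ := r.continuous
  set C' : ℝ := max C 1 with hC'
  have hC'0 : 0 < C' := lt_of_lt_of_le one_pos (le_max_right _ _)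
  have hb : 0 < C' / δ := div_pos hC'0 hδ
  -- eventually in `S`: `ρ₀ ≤ (C'/δ)^{n/S} e^{-m₀ n}`
  have hev : ∀ᶠ S : ℕ in atTop, ρ₀ ≤ (C' / δ) ^ ((n : ℝ) / S) * Real.exp (-(m₀ * n)) := by
    filter_upwards [hLG, eventually_ge_atTop (max (max S₀ n) 1)] with S hS hS'
    obtain ⟨hδS, hratio⟩ := hS
    have hS0 : S₀ ≤ S := le_trans (le_max_left _ _) ((le_max_left _ _).trans hS')
    have hnS : n ≤ S := le_trans (le_max_right _ _) ((le_max_left _ _).trans hS')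
    have hS1 : 1 ≤ S := (le_max_right _ _).trans hS'
    set c0 := latticeConnectedCorr r.ρ β (2 * S + 1) A.F A.F 0 with hc0
    have hc0pos : 0 < c0 := lt_of_lt_of_le hδ hδS
    have hSC : latticeConnectedCorr r.ρ β (2 * S + 1) A.F A.F S ≤ C' * Real.exp (-(m₀ * S)) :=
      ((le_abs_self _).trans (hC S hS0 S le_rfl)).trans
        (mul_le_mul_of_nonneg_right (le_max_left _ _) (Real.exp_pos _).le)
    have hint := latticeConnectedCorr_self_le_interpolate r.ρ hρ hβ hS1 A hA hc0pos hC'0 hSC hnS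
    -- monotonicity of the base: `C'/c0 ≤ C'/δ`
    have hexp0 : (0 : ℝ) ≤ (n : ℝ) / S := div_nonneg (Nat.cast_nonneg _) (Nat.cast_nonneg _)
    have hbase : (C' / c0) ^ ((n : ℝ) / S) ≤ (C' / δ) ^ ((n : ℝ) / S) :=
      Real.rpow_le_rpow (div_pos hC'0 hc0pos).le (div_le_div_of_nonneg_left hC'0.le hδ hδS) hexp0
    have h1 : ρ₀ * c0 ≤ c0 * ((C' / δ) ^ ((n : ℝ) / S) * Real.exp (-(m₀ * n))) :=
      calc ρ₀ * c0 ≤ latticeConnectedCorr r.ρ β (2 * S + 1) A.F A.F n := hratio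
        _ ≤ c0 * (C' / c0) ^ ((n : ℝ) / S) * Real.exp (-(m₀ * n)) := hint
        _ ≤ c0 * (C' / δ) ^ ((n : ℝ) / S) * Real.exp (-(m₀ * n)) :=
            mul_le_mul_of_nonneg_right (mul_le_mul_of_nonneg_left hbase hc0pos.le)
              (Real.exp_pos _).le
        _ = c0 * ((C' / δ) ^ ((n : ℝ) / S) * Real.exp (-(m₀ * n))) := by ring
    rw [mul_comm ρ₀ c0] at h1
    exact le_of_mul_le_mul_left h1 hc0pos
  -- pass to the limit `S → ∞`
  have hlim : Tendsto (fun S : ℕ => (C' / δ) ^ ((n : ℝ) / S) * Real.exp (-(m₀ * n))) atTop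
      (𝓝 (1 * Real.exp (-(m₀ * n)))) :=
    (tendsto_rpow_div_atTop_one hb n).mul tendsto_const_nhds
  have := ge_of_tendsto hlim hev
  rw [one_mul] at this
  exact absurd hρ₀ (not_lt.mpr this)

/-- **The correlation length of `A` diverges at weak coupling** (lattice units): for every rate
`m₀ > 0`, eventually in `β` the pair `(A, A)` does not cluster torus-uniformly at rate `m₀`. -/
def CorrelationLengthDiverges (r : LatticeRep G) (A : YMSpecies G) : Prop :=
  ∀ m₀ : ℝ, 0 < m₀ → ∀ᶠ β : ℝ in atTop, ¬ ClustersAtRate r β A A m₀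

/-- **Typed local-Gaussianity input** for the time-zero spatial species `A`: for every rate
`m₀ > 0` there are a separation `n`, a ratio `ρ₀ > e^{-m₀ n}` and a variance floor `δ > 0` such that,
for all large `β` and then all large `S`, `c_{A,A}(0; S) ≥ δ` and `c_{A,A}(n; S) ≥ ρ₀ c_{A,A}(0; S)`.
(Paper: local Gaussianity, uniform in the volume, and polynomial decay of the free lattice
ratios `κ(n)/κ(0)`; the floor `δ` may depend on `β`.) -/
def HasLocalGaussianRatios (r : LatticeRep G) (A : YMSpecies G) : Prop :=
  ∀ m₀ : ℝ, 0 < m₀ → ∃ n : ℕ, ∃ ρ₀ : ℝ, Real.exp (-(m₀ * n)) < ρ₀ ∧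
    ∀ᶠ β : ℝ in atTop, ∃ δ : ℝ, 0 < δ ∧
      ∀ᶠ S : ℕ in atTop, δ ≤ latticeConnectedCorr r.ρ β (2 * S + 1) A.F A.F 0 ∧
        ρ₀ * latticeConnectedCorr r.ρ β (2 * S + 1) A.F A.F 0 ≤
          latticeConnectedCorr r.ρ β (2 * S + 1) A.F A.F n

/-- **IR-0 skeleton**: the typed local-Gaussianity input for a time-zero spatial species forces
its correlation length (in lattice units) to diverge at weak coupling. [this unit's] -/
theorem correlationLengthDiverges_of_localRatios (r : LatticeRep G) (A : YMSpecies G)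
    (hA : IsTimeZeroSpatial A) (h : HasLocalGaussianRatios r A) :
    CorrelationLengthDiverges r A := by
  intro m₀ hm₀
  obtain ⟨n, ρ₀, hρ₀, hβ⟩ := h m₀ hm₀
  filter_upwards [hβ, eventually_ge_atTop (0 : ℝ)] with β hδ hβ0
  obtain ⟨δ, hδ, hS⟩ := hδ
  exact not_clustersAtRate_of_ratio_lower_bound r hβ0 A hA hδ hρ₀ hS

/-- In particular such a species never clusters at a `β`-uniform positive rate along `β → ∞`:
for every `m₀ > 0` and every sequence `β_k → ∞`, eventually `¬ ClustersAtRate r (β_k) A A m₀`. -/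
theorem eventually_not_clustersAtRate_of_localRatios (r : LatticeRep G) (A : YMSpecies G)
    (hA : IsTimeZeroSpatial A) (h : HasLocalGaussianRatios r A) {m₀ : ℝ} (hm₀ : 0 < m₀)
    {βk : ℕ → ℝ} (hβ : Tendsto βk atTop atTop) :
    ∀ᶠ k in atTop, ¬ ClustersAtRate r (βk k) A A m₀ :=
  hβ.eventually (correlationLengthDiverges_of_localRatios r A hA h m₀ hm₀)

end Summit.QuantumFields.YangMills.Theorems.SoloBlind

end
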